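import Summits.ResolutionOfSingularities.ResolutionOfSingularities.Theorems.MarkedTransferCampaignW46LooseExitTree
import Summits.ResolutionOfSingularities.ResolutionOfSingularities.Theorems.MarkedTransferCampaignW46ExitTreeGerm
import Literature.AlgebraicGeometry.Resolution.BlowupPointSubalgebra
import HarnessLib

/-!
# [OURS · L1 W4.6 rung (i-b)] The loose exit count is invariant under field isomorphisms; the germ invariant
# `ν̃(R, I, b)` of an abstract local ring
# (cell res-hironaka, LADDER-RESOLUTION rung L, D-0089; campaign s46, prover res-L1-s46-pv-1; host route MarkedTransfer,
# `--supports stmt-ResolutionOfSingularities-16155`)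

HONEST FRAMING. Nothing here is a statement of H. Hironaka's manuscript (2017-03-23, [Hironaka2017]); pure commutative
algebra, the loose-tree analogue of res-L1-s46-pv-8's `MarkedTransferCampaignW46ExitTree{Transport,Germ}.lean` (p-ids on the
campaign table), whose node map `nodeMap`, transport of singular nodes / quadratic transforms / controlled transforms and
sigma bookkeeping are reused verbatim. AI-written; weaker than expert review. No `sorry`; axioms standard.

## Contents

* `exactOrder_eq_of_iff`, `exactOrder_map_subringMapEquiv`, `map_looseTransform` — the loose transform transports along
  a field isomorphism `φ : K ≃+* L`.
* `isIsolatedNode_nodeMap`, `looseStep_nodeMap`, `image_nodeMap_looseExitTree`, **`looseExitCount_map_ringEquiv`** —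
  `ν̃(φ S, φ J, b) = ν̃(S, J, b)`.
* `germLooseExitCount R I b` — the loose exit count of `(R, I, b)` read in `Frac R` (for a domain `R`; `0` else);
  **`germLooseExitCount_eq_looseExitCount`** (computable in ANY realisation `f : R ↪ K` of the fraction field) and
  **`germLooseExitCount_map_ringEquiv`** (invariance under ring isomorphisms) — the shape res-L1-s46-pv-9's dictionary
  consumes (`offCentre_eq_of_germLocal`).

## References

* O. Zariski, P. Samuel, *Commutative Algebra* II (1960), Appendix 5. [ZariskiSamuel1960]
-/

noncomputable section

open IsLocalRing

-- single-problem summit: the doubled namespace component `ResolutionOfSingularities` is forced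
set_option linter.dupNamespace false

namespace Summit.ResolutionOfSingularities.ResolutionOfSingularities.Theorems.CampaignW46

open Literature.AlgebraicGeometry.Resolution

universe u

variable {K L : Type u} [Field K] [Field L]

/-! ## Transport of the exact order and of the loose transform -/

/-- The exact order is determined by the predicate `J ⊆ 𝔪^k`. [folklore] -/
theorem exactOrder_eq_of_iff {S : Subring K} {S' : Subring L} [IsLocalRing S] [IsLocalRing S'] {J : Ideal S}
    {J' : Ideal S'} (h : ∀ k, J ≤ maximalIdeal S ^ k ↔ J' ≤ maximalIdeal S' ^ k) :
    exactOrder S J = exactOrder S' J' := by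
  classical
  by_cases hex : ∃ k, ¬ J ≤ maximalIdeal S ^ (k + 1)
  · have hex' : ∃ k, ¬ J' ≤ maximalIdeal S' ^ (k + 1) := by
      obtain ⟨k, hk⟩ := hex
      exact ⟨k, fun hle => hk ((h _).mpr hle)⟩
    rw [exactOrder, exactOrder, dif_pos hex, dif_pos hex', Nat.find_eq_iff]
    refine ⟨fun hle => Nat.find_spec hex' ((h _).mp hle), fun n hn hle => ?_⟩
    exact Nat.find_min hex' hn fun hle' => hle ((h _).mpr hle')
  · have hex' : ¬ ∃ k, ¬ J' ≤ maximalIdeal S' ^ (k + 1) := by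
      rintro ⟨k, hk⟩
      exact hex ⟨k, fun hle => hk ((h _).mp hle)⟩
    rw [exactOrder, exactOrder, dif_neg hex, dif_neg hex']

/-- The exact order transports along a field isomorphism. [folklore] -/
theorem exactOrder_map_subringMapEquiv (φ : K ≃+* L) {S : Subring K} [IsLocalRing S]
    [IsLocalRing (S.map (φ : K →+* L))] (J : Ideal S) :
    exactOrder (S.map (φ : K →+* L)) (J.map (subringMapEquiv φ S)) = exactOrder S J :=
  (exactOrder_eq_of_iff fun k => (map_le_pow_maximalIdeal_iff φ J k).symm).symm

/-- The loose exponent transports along a field isomorphism. [folklore] -/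
theorem looseExponent_map_subringMapEquiv (φ : K ≃+* L) (b : ℕ) {S : Subring K} [IsLocalRing S]
    [IsLocalRing (S.map (φ : K →+* L))] (J : Ideal S) :
    looseExponent b (S.map (φ : K →+* L)) (J.map (subringMapEquiv φ S)) = looseExponent b S J := by
  rw [looseExponent, looseExponent, exactOrder_map_subringMapEquiv]

/-- **The loose transform transports**: `φ((J S' : x^m)) = (φ(J) φ(S') : φ(x)^m)`. [folklore] -/
theorem map_looseTransform (φ : K ≃+* L) {S : Subring K} [IsLocalRing S] [IsLocalRing (S.map (φ : K →+* L))]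
    (b : ℕ) (J : Ideal S) (S' : Subring K) :
    (looseTransform b S J S').map (subringMapEquiv φ S') =
      looseTransform b (S.map (φ : K →+* L)) (J.map (subringMapEquiv φ S)) (S'.map (φ : K →+* L)) := by
  rw [looseTransform, looseTransform, map_ctrlTransform, looseExponent_map_subringMapEquiv]

/-! ## Transport of isolated nodes, loose steps and the loose tree -/

/-- Prime elements correspond under the restricted isomorphism. [folklore] -/
theorem prime_symm_of_prime (φ : K ≃+* L) {S : Subring K} {q : S.map (φ : K →+* L)} (hq : Prime q) :
    Prime ((subringMapEquiv φ S).symm q) :=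
  (MulEquiv.prime_iff (subringMapEquiv φ S).symm.toMulEquiv).mpr hq

/-- Isolated nodes transport. [folklore] -/
theorem isIsolatedNode_nodeMap (φ : K ≃+* L) {b : ℕ} {n : MarkedNode K} (h : IsIsolatedNode b n) :
    IsIsolatedNode b (nodeMap φ n) := by
  obtain ⟨hsing, hiso, hjap⟩ := h
  obtain ⟨hreg, -, hof, -⟩ := id hsing
  haveI := hreg
  set e := subringMapEquiv φ n.1 with he
  refine ⟨isSingularNode_nodeMap φ hsing, fun q hq hle => ?_, fun P hP => ?_⟩
  · -- `φ(J) ⊆ (q^b)` pulls back to `J ⊆ ((e⁻¹ q)^b)`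
    apply hiso (e.symm q) (prime_symm_of_prime φ hq)
    change n.2.map (e : n.1 →+* n.1.map (φ : K →+* L)) ≤ Ideal.span {q ^ b} at hle
    intro z hz
    have hz' : e z ∈ Ideal.span {q ^ b} := hle (Ideal.mem_map_of_mem _ hz)
    obtain ⟨c, hc⟩ := Ideal.mem_span_singleton'.mp hz'
    rw [Ideal.mem_span_singleton']
    refine ⟨e.symm c, e.injective ?_⟩
    rw [map_mul, map_pow, e.apply_symm_apply, e.apply_symm_apply]
    exact hc
  · -- Japanese quotients transport along `S ⧸ e⁻¹(P) ≃ φ(S) ⧸ P`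
    haveI := hP
    set P₀ : Ideal n.1 := P.comap e.toRingHom with hP₀
    haveI hP₀p : P₀.IsPrime := Ideal.comap_isPrime _ _
    haveI := hjap P₀ hP₀p
    have hPe : P₀.map (e : n.1 →+* n.1.map (φ : K →+* L)) = P := by
      rw [hP₀]
      exact Ideal.map_comap_of_surjective _ e.surjective P
    let eq : n.1 ⧸ P₀ ≃+* (n.1.map (φ : K →+* L)) ⧸ P := Ideal.quotientEquiv P₀ P e hPe.symm
    haveI : IsDomain ((n.1.map (φ : K →+* L)) ⧸ P) := Ideal.Quotient.isDomain P
    exact module_finite_integralClosure_of_ringEquiv eq (FractionRing (n.1 ⧸ P₀))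
      (FractionRing ((n.1.map (φ : K →+* L)) ⧸ P))

/-- Loose steps transport. [folklore] -/
theorem looseStep_nodeMap (φ : K ≃+* L) {b : ℕ} {n n' : MarkedNode K} (h : LooseStep b n n') :
    LooseStep b (nodeMap φ n) (nodeMap φ n') := by
  obtain ⟨ht, hloc, hq, hd, he⟩ := h
  haveI := hloc
  haveI hloc' : IsLocalRing (n.1.map (φ : K →+* L)) := (subringMapEquiv φ n.1).isLocalRing
  refine ⟨isIsolatedNode_nodeMap φ ht, hloc', isQuadraticTransform_map φ hq, ?_, ?_⟩
  · change ringKrullDim (n'.1.map (φ : K →+* L)) = 2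
    rw [← ringKrullDim_eq_of_ringEquiv (subringMapEquiv φ n'.1), hd]
  · change n'.2.map (subringMapEquiv φ n'.1) =
      looseTransform b (n.1.map (φ : K →+* L)) (n.2.map (subringMapEquiv φ n.1)) (n'.1.map (φ : K →+* L))
    rw [he, map_looseTransform]

/-- Reachability in the loose tree transports. [folklore] -/
theorem reflTransGen_looseStep_nodeMap (φ : K ≃+* L) {b : ℕ} {n m : MarkedNode K}
    (h : Relation.ReflTransGen (LooseStep b) n m) :
    Relation.ReflTransGen (LooseStep b) (nodeMap φ n) (nodeMap φ m) := by
  induction h with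
  | refl => exact Relation.ReflTransGen.refl
  | tail _ hs ih => exact ih.tail (looseStep_nodeMap φ hs)

/-- The loose tree transports into the loose tree. [folklore] -/
theorem nodeMap_mem_looseExitTree (φ : K ≃+* L) {b : ℕ} {n₀ m : MarkedNode K} (h : m ∈ looseExitTree b n₀) :
    nodeMap φ m ∈ looseExitTree b (nodeMap φ n₀) :=
  ⟨reflTransGen_looseStep_nodeMap φ h.1, isSingularNode_nodeMap φ h.2⟩

/-- **The loose tree transports onto the loose tree.** [folklore] -/
theorem image_nodeMap_looseExitTree (φ : K ≃+* L) (b : ℕ) (n₀ : MarkedNode K) :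
    nodeMap φ '' looseExitTree b n₀ = looseExitTree b (nodeMap φ n₀) := by
  apply le_antisymm
  · rintro _ ⟨m, hm, rfl⟩
    exact nodeMap_mem_looseExitTree φ hm
  · intro m hm
    refine ⟨nodeMap φ.symm m, ?_, ?_⟩
    · have := nodeMap_mem_looseExitTree φ.symm hm
      rwa [nodeMap_symm_nodeMap] at this
    · have := nodeMap_symm_nodeMap φ.symm m
      rwa [RingEquiv.symm_symm] at this

/-- **The loose exit count is invariant under field isomorphisms**: `ν̃(φ S, φ J, b) = ν̃(S, J, b)`.
[cite: ZariskiSamuel1960, Appendix 5] -/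
theorem looseExitCount_map_ringEquiv (φ : K ≃+* L) (b : ℕ) (S : Subring K) (J : Ideal S) :
    looseExitCount b (S.map (φ : K →+* L)) (J.map (subringMapEquiv φ S)) = looseExitCount b S J := by
  rw [looseExitCount, looseExitCount, show (⟨S.map (φ : K →+* L), J.map (subringMapEquiv φ S)⟩ : MarkedNode L) =
      nodeMap φ ⟨S, J⟩ from rfl, ← image_nodeMap_looseExitTree, Set.ncard_image_of_injective _ (nodeMap_injective φ)]

/-- Loose exit counts of marked nodes with the same ring and the same image of the ideal agree. [folklore] -/
theorem looseExitCount_congr {b : ℕ} {S S' : Subring K} {J : Ideal S} {J' : Ideal S'}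
    (h1 : S = S') (h2 : ((↑) : S → K) '' (J : Set S) = ((↑) : S' → K) '' (J' : Set S')) :
    looseExitCount b S J = looseExitCount b S' J' := by
  have : (⟨S, J⟩ : MarkedNode K) = ⟨S', J'⟩ := MarkedNode.ext_of_image h1 h2
  rw [looseExitCount, looseExitCount, this]

/-! ## The germ invariant of an abstract ring -/

section Germ

/-- The loose exit count of `(R, I, b)` read in the fraction field of the domain `R`. [folklore] -/
def domainLooseExitCount (R : Type u) [CommRing R] [IsDomain R] (I : Ideal R) (b : ℕ) : ℕ :=
  looseExitCount b (algebraMap R (FractionRing R)).range (I.map (algebraMap R (FractionRing R)).rangeRestrict)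

open Classical in
/-- **The germ invariant `ν̃(R, I, b)`** of rung (i-b), evaluated at stalks `(𝒪_{Z,ξ}, J_ξ, b)`: for a domain `R` the loose
exit count of `(R, I, b)` read in `Frac R`; `0` else (junk). [folklore] -/
def germLooseExitCount (R : Type u) [CommRing R] (I : Ideal R) (b : ℕ) : ℕ :=
  if hd : IsDomain R then @domainLooseExitCount R _ hd I b else 0

/-- The domain branch. [folklore] -/
theorem germLooseExitCount_eq_domainLooseExitCount {R : Type u} [CommRing R] [hd : IsDomain R] (I : Ideal R)
    (b : ℕ) : germLooseExitCount R I b = domainLooseExitCount R I b := by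
  classical
  rw [germLooseExitCount, dif_pos hd]

/-- **The germ invariant may be computed in ANY realisation of the fraction field**: for a domain `R` and an injective
`f : R →+* K` into a field all of whose elements are fractions of elements of `f(R)`,
`ν̃(R, I, b) = looseExitCount b f(R) f(I)`. [folklore] -/
theorem germLooseExitCount_eq_looseExitCount {R : Type u} [CommRing R] [IsDomain R]
    {K : Type u} [Field K] (f : R →+* K) (hf : Function.Injective f)
    (hfrac : ∀ z : K, ∃ a c : R, f c ≠ 0 ∧ z = f a / f c) (I : Ideal R) (b : ℕ) :
    germLooseExitCount R I b = looseExitCount b f.range (I.map f.rangeRestrict) := by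
  rw [germLooseExitCount_eq_domainLooseExitCount, domainLooseExitCount]
  set F := FractionRing R with hF
  set ι : R →+* F := algebraMap R F with hι
  -- the isomorphism `Frac R ≃+* K` over `R`
  set φ₀ : F →+* K := IsFractionRing.lift hf with hφ₀
  have hφι : ∀ x, φ₀ (ι x) = f x := fun x => IsFractionRing.lift_algebraMap hf x
  have hbij : Function.Bijective φ₀ := by
    refine ⟨φ₀.injective, fun z => ?_⟩
    obtain ⟨a, c, hc, rfl⟩ := hfrac z
    refine ⟨ι a / ι c, ?_⟩
    rw [map_div₀, hφι, hφι]
  set φ : F ≃+* K := RingEquiv.ofBijective φ₀ hbij with hφ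
  have hφι' : ∀ x, φ (ι x) = f x := hφι
  rw [← looseExitCount_map_ringEquiv φ]
  refine looseExitCount_congr ?_ ?_
  · ext w
    constructor
    · intro hw
      obtain ⟨v, ⟨x, rfl⟩, rfl⟩ := Subring.mem_map.mp hw
      exact ⟨x, (hφι' x).symm⟩
    · rintro ⟨x, rfl⟩
      exact Subring.mem_map.mpr ⟨ι x, ⟨x, rfl⟩, hφι' x⟩
  · rw [coe_image_map_subringMapEquiv, coe_image_map_rangeRestrict, coe_image_map_rangeRestrict,
      ← Set.image_comp]
    apply Set.image_congr
    intro x _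
    exact hφι' x

/-- **Ring-isomorphism invariance of the germ invariant**: `ν̃(R', e(I), b) = ν̃(R, I, b)`. [folklore] -/
theorem germLooseExitCount_map_ringEquiv {R R' : Type u} [CommRing R] [CommRing R'] (e : R ≃+* R') (I : Ideal R)
    (b : ℕ) : germLooseExitCount R' (I.map e) b = germLooseExitCount R I b := by
  classical
  by_cases hd : IsDomain R
  · haveI := hd
    haveI : IsDomain R' := MulEquiv.isDomain R e.symm.toMulEquiv
    set F' := FractionRing R' with hF'
    set f' : R' →+* F' := algebraMap R' F' with hf'
    have hf'inj : Function.Injective f' := IsFractionRing.injective R' F'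
    have hfrac' : ∀ z : F', ∃ a c : R', f' c ≠ 0 ∧ z = f' a / f' c := fun z => by
      obtain ⟨a, c, hc, hz⟩ := IsFractionRing.div_surjective (A := R') z
      exact ⟨a, c, IsFractionRing.to_map_ne_zero_of_mem_nonZeroDivisors hc, hz.symm⟩
    set f : R →+* F' := f'.comp e.toRingHom with hf
    have hfinj : Function.Injective f := hf'inj.comp e.injective
    have hfrac : ∀ z : F', ∃ a c : R, f c ≠ 0 ∧ z = f a / f c := fun z => by
      obtain ⟨a, c, hc, hz⟩ := hfrac' z
      refine ⟨e.symm a, e.symm c, ?_, ?_⟩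
      · change f' (e.toRingHom (e.symm c)) ≠ 0
        rw [RingEquiv.toRingHom_eq_coe, RingEquiv.coe_toRingHom, e.apply_symm_apply]; exact hc
      · change z = f' (e.toRingHom (e.symm a)) / f' (e.toRingHom (e.symm c))
        rw [RingEquiv.toRingHom_eq_coe, RingEquiv.coe_toRingHom, e.apply_symm_apply, e.apply_symm_apply]
        exact hz
    rw [germLooseExitCount_eq_looseExitCount f' hf'inj hfrac', germLooseExitCount_eq_looseExitCount f hfinj hfrac]
    have hfe : ∀ x : R, f x = f' (e x) := fun _ => rfl
    refine looseExitCount_congr ?_ ?_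
    · ext w
      constructor
      · rintro ⟨y, rfl⟩
        exact ⟨e.symm y, by rw [hfe, e.apply_symm_apply]⟩
      · rintro ⟨x, rfl⟩
        exact ⟨e x, (hfe x).symm⟩
    · rw [coe_image_map_rangeRestrict, coe_image_map_rangeRestrict]
      ext w
      simp only [Set.mem_image, SetLike.mem_coe]
      constructor
      · rintro ⟨y, hy, rfl⟩
        obtain ⟨x, hx, rfl⟩ := (Ideal.mem_map_of_equiv e y).mp hy
        exact ⟨x, hx, hfe x⟩
      · rintro ⟨x, hx, rfl⟩
        exact ⟨e x, Ideal.mem_map_of_mem _ hx, (hfe x).symm⟩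
  · have hd' : ¬ IsDomain R' := fun hd' => hd (by haveI := hd'; exact MulEquiv.isDomain R' e.toMulEquiv)
    rw [germLooseExitCount, germLooseExitCount, dif_neg hd', dif_neg hd]

end Germ

end Summit.ResolutionOfSingularities.ResolutionOfSingularities.Theorems.CampaignW46

end
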